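import Mathlib.Analysis.Calculus.SmoothSeries
import Mathlib.Analysis.Calculus.BumpFunction.FiniteDimension
import Mathlib.Analysis.Calculus.ContDiff.Bounds
import HarnessLib

/-!
# Series of smooth functions with locally summable derivative bounds

Topic `Analysis/Calculus`; namespace `Literature.Analysis.Calculus`. Mathlib's `contDiff_tsum` and
`iteratedFDeriv_tsum` (`Mathlib.Analysis.Calculus.SmoothSeries`) differentiate a series
`∑' i, f i x` term by term under summable bounds on all derivatives which are UNIFORM ON THE WHOLE
SPACE. For series such as theta series `∑_{a} Φ(a · y · exp X)` in the variable `X` the natural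
bounds are only uniform for `X` in a ball. This file proves the localized statement on a
finite-dimensional real space `E`:

* `exists_contDiff_cutoff_eq_self` — a smooth map `χ : E → E` with `χ x = x` on the closed ball of
  radius `R/2`, `‖χ x‖ ≤ R` everywhere, and every derivative bounded on `E` (the product of a
  Mathlib bump function `ContDiffBump` with the identity);
* `contDiffAt_tsum_of_norm_iteratedFDeriv_le` — if the `f i` are smooth and
  `‖iteratedFDeriv ℝ k (f i) x‖ ≤ v k i` for `‖x‖ ≤ R` with `∑_i v k i < ∞` for every `k`, then
  `x ↦ ∑' i, f i x` is smooth at `0`, and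
  `iteratedFDeriv_tsum_apply_zero_of_norm_iteratedFDeriv_le` — its iterated derivatives at `0` are
  the sums of those of the terms, with the bound `norm_iteratedFDeriv_tsum_apply_zero_le`.

Proof: apply the global theorems to `f i ∘ χ`, whose derivatives are bounded on all of `E` by the
Faà di Bruno estimate `norm_iteratedFDeriv_comp_le`, and which agree with `f i` near `0`. Folklore.
-/

noncomputable section

open Set Metric Filter Function
open scoped Topology ContDiff

namespace Literature.Analysis.Calculus

variable {E F : Type*} [NormedAddCommGroup E] [NormedSpace ℝ E] [FiniteDimensional ℝ E]
  [NormedAddCommGroup F] [NormedSpace ℝ F] [CompleteSpace F]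

/-- **A smooth cut-off of the identity.** For `R > 0` there is a smooth `χ : E → E` with `χ x = x`
for `‖x‖ ≤ R/2`, `‖χ x‖ ≤ R` for all `x`, and all derivatives of all orders bounded on `E`
(`χ x = φ x • x` for a bump function `φ` equal to `1` on the ball of radius `R/2` and supported in the
ball of radius `R`). [folklore] -/
theorem exists_contDiff_cutoff_eq_self {R : ℝ} (hR : 0 < R) :
    ∃ χ : E → E, ContDiff ℝ ∞ χ ∧ (∀ x, ‖x‖ ≤ R / 2 → χ x = x) ∧ (∀ x, ‖χ x‖ ≤ R) ∧
      ∀ i : ℕ, ∃ D : ℝ, ∀ x, ‖iteratedFDeriv ℝ i χ x‖ ≤ D := by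
  let φ : ContDiffBump (0 : E) := ⟨R / 2, R, by positivity, by linarith⟩
  have hsmooth : ContDiff ℝ ∞ fun x => φ x • x := φ.contDiff.smul contDiff_id
  refine ⟨fun x => φ x • x, hsmooth, fun x hx => ?_, fun x => ?_, fun i => ?_⟩
  · change φ x • x = x
    rw [φ.one_of_mem_closedBall (by simpa using hx), one_smul]
  · change ‖φ x • x‖ ≤ R
    by_cases hx : ‖x‖ ≤ R
    · rw [norm_smul, Real.norm_of_nonneg φ.nonneg]
      exact (mul_le_of_le_one_left (norm_nonneg _) φ.le_one).trans hx
    · rw [φ.zero_of_le_dist (by rw [dist_zero_right]; exact (not_le.1 hx).le), zero_smul, norm_zero]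
      exact hR.le
  · have hcs : HasCompactSupport fun x => φ x • x :=
      (φ.hasCompactSupport.smul_right (f' := fun x : E => x))
    have hcont : Continuous (iteratedFDeriv ℝ i fun x => φ x • x) :=
      hsmooth.continuous_iteratedFDeriv (by exact_mod_cast le_top)
    exact hcont.bounded_above_of_compact_support (hcs.iteratedFDeriv i)

omit [FiniteDimensional ℝ E] [CompleteSpace F] in
/-- The derivative bounds of a series on a ball are non-negative at the centre's terms: if
`‖iteratedFDeriv ℝ k (f i) x‖ ≤ v k i` for `‖x‖ ≤ R` then `0 ≤ v k i`. [folklore] -/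
theorem nonneg_of_norm_iteratedFDeriv_le {α : Type*} {f : α → E → F} {v : ℕ → α → ℝ} {R : ℝ}
    (hR : 0 < R) (h'f : ∀ (k : ℕ) (i : α) (x : E), ‖x‖ ≤ R → ‖iteratedFDeriv ℝ k (f i) x‖ ≤ v k i)
    (k : ℕ) (i : α) : 0 ≤ v k i :=
  (norm_nonneg _).trans (h'f k i 0 (by rw [norm_zero]; exact hR.le))

omit [FiniteDimensional ℝ E] [CompleteSpace F] in
/-- **Global derivative bounds for the cut-off terms.** With `χ` as in
`exists_contDiff_cutoff_eq_self` and bounds `v k i` for the derivatives of `f i` on the closed ball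
of radius `R`, the compositions `f i ∘ χ` have derivatives bounded on all of `E` by
`n ! · (∑_{k ≤ n} v k i) · D ^ n` (Faà di Bruno, `norm_iteratedFDeriv_comp_le`). [folklore] -/
theorem norm_iteratedFDeriv_comp_cutoff_le {α : Type*} {f : α → E → F} {v : ℕ → α → ℝ} {R : ℝ}
    (hR : 0 < R) (hf : ∀ i, ContDiff ℝ ∞ (f i))
    (h'f : ∀ (k : ℕ) (i : α) (x : E), ‖x‖ ≤ R → ‖iteratedFDeriv ℝ k (f i) x‖ ≤ v k i)
    {χ : E → E} (hχ : ContDiff ℝ ∞ χ) (hχR : ∀ x, ‖χ x‖ ≤ R)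
    {D : ℝ} (hD1 : 1 ≤ D) (n : ℕ) (hD : ∀ i, 1 ≤ i → i ≤ n → ∀ x, ‖iteratedFDeriv ℝ i χ x‖ ≤ D)
    (i : α) (x : E) :
    ‖iteratedFDeriv ℝ n (f i ∘ χ) x‖ ≤ n.factorial * (∑ k ∈ Finset.range (n + 1), v k i) * D ^ n := by
  refine norm_iteratedFDeriv_comp_le (hf i) hχ (by exact_mod_cast le_top) x (fun k hk => ?_)
    (fun k hk1 hkn => ?_)
  · refine (h'f k i (χ x) (hχR x)).trans ?_
    refine Finset.single_le_sum (f := fun k => v k i)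
      (fun k _ => nonneg_of_norm_iteratedFDeriv_le hR h'f k i) ?_
    exact Finset.mem_range.2 (Nat.lt_succ_of_le hk)
  · exact (hD k hk1 hkn x).trans (le_self_pow₀ hD1 (Nat.one_le_iff_ne_zero.1 hk1))

/-- **Smoothness of a series at a point from derivative bounds on a ball** (localized
`contDiff_tsum`): if every `f i` is smooth and `‖iteratedFDeriv ℝ k (f i) x‖ ≤ v k i` for `‖x‖ ≤ R`,
with `∑_i v k i < ∞` for each `k`, then `x ↦ ∑' i, f i x` is smooth at `0`, and its iterated
derivatives at `0` are the (summable) series of those of the terms. [folklore] -/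
theorem contDiffAt_tsum_and_iteratedFDeriv_eq {α : Type*} {f : α → E → F} {v : ℕ → α → ℝ} {R : ℝ}
    (hR : 0 < R) (hf : ∀ i, ContDiff ℝ ∞ (f i)) (hv : ∀ k, Summable (v k))
    (h'f : ∀ (k : ℕ) (i : α) (x : E), ‖x‖ ≤ R → ‖iteratedFDeriv ℝ k (f i) x‖ ≤ v k i) :
    ContDiffAt ℝ ∞ (fun x => ∑' i, f i x) 0 ∧
      ∀ k : ℕ, iteratedFDeriv ℝ k (fun x => ∑' i, f i x) 0 = ∑' i, iteratedFDeriv ℝ k (f i) 0 := by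
  obtain ⟨χ, hχ, hχid, hχR, hχD⟩ := exists_contDiff_cutoff_eq_self (E := E) hR
  choose D hD using hχD
  -- a bound `Dn n ≥ 1` for the derivatives of `χ` of orders `1 ≤ i ≤ n`
  let Dn : ℕ → ℝ := fun n => max 1 (∑ i ∈ Finset.range (n + 1), |D i|)
  have hDn1 : ∀ n, 1 ≤ Dn n := fun n => le_max_left _ _
  have hDn : ∀ n i, 1 ≤ i → i ≤ n → ∀ x, ‖iteratedFDeriv ℝ i χ x‖ ≤ Dn n := by
    intro n i _ hin x
    refine (hD i x).trans ((le_abs_self _).trans (le_trans ?_ (le_max_right _ _)))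
    exact Finset.single_le_sum (f := fun i => |D i|) (fun _ _ => abs_nonneg _)
      (Finset.mem_range.2 (Nat.lt_succ_of_le hin))
  -- the cut-off terms and their global bounds
  set g : α → E → F := fun i => f i ∘ χ with hg
  set w : ℕ → α → ℝ := fun n i =>
    n.factorial * (∑ k ∈ Finset.range (n + 1), v k i) * Dn n ^ n with hw
  have hgs : ∀ i, ContDiff ℝ ∞ (g i) := fun i => (hf i).comp hχ
  have hwb : ∀ (n : ℕ) (i : α) (x : E), ‖iteratedFDeriv ℝ n (g i) x‖ ≤ w n i := fun n i x =>
    norm_iteratedFDeriv_comp_cutoff_le hR hf h'f hχ hχR (hDn1 n) n (hDn n) i x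
  have hws : ∀ n, Summable (w n) := fun n => by
    have h1 : Summable fun i => ∑ k ∈ Finset.range (n + 1), v k i :=
      summable_sum fun k _ => hv k
    simpa only [hw, mul_assoc, mul_comm, mul_left_comm] using (h1.mul_left _).mul_right (Dn n ^ n)
  have hG : ContDiff ℝ ∞ fun x => ∑' i, g i x :=
    contDiff_tsum (N := (⊤ : ℕ∞)) hgs (fun n _ => hws n) fun n i x _ => hwb n i x
  have hGd : ∀ k : ℕ, iteratedFDeriv ℝ k (fun x => ∑' i, g i x) =
      fun x => ∑' i, iteratedFDeriv ℝ k (g i) x := fun k =>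
    iteratedFDeriv_tsum (N := (⊤ : ℕ∞)) hgs (fun n _ => hws n) (fun n i x _ => hwb n i x)
      (by exact_mod_cast le_top)
  -- `g i = f i` near `0`
  have hball : ∀ x ∈ ball (0 : E) (R / 2), χ x = x := fun x hx =>
    hχid x (by rw [mem_ball, dist_zero_right] at hx; exact hx.le)
  have hnhds : ball (0 : E) (R / 2) ∈ 𝓝 (0 : E) := ball_mem_nhds _ (by positivity)
  have hgi : ∀ i, g i =ᶠ[𝓝 0] f i := fun i =>
    mem_of_superset hnhds fun x hx => by
      change f i (χ x) = f i x
      rw [hball x hx]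
  have hsum : (fun x => ∑' i, g i x) =ᶠ[𝓝 0] fun x => ∑' i, f i x :=
    mem_of_superset hnhds fun x hx => by
      change ∑' i, f i (χ x) = ∑' i, f i x
      rw [hball x hx]
  refine ⟨hG.contDiffAt.congr_of_eventuallyEq hsum.symm, fun k => ?_⟩
  rw [← (hsum.iteratedFDeriv ℝ k).self_of_nhds, hGd k]
  exact tsum_congr fun i => ((hgi i).iteratedFDeriv ℝ k).self_of_nhds

/-- **Smoothness of a series at `0`** from summable derivative bounds on a ball (localized
`contDiff_tsum`). [folklore] -/
theorem contDiffAt_tsum_of_norm_iteratedFDeriv_le {α : Type*} {f : α → E → F} {v : ℕ → α → ℝ}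
    {R : ℝ} (hR : 0 < R) (hf : ∀ i, ContDiff ℝ ∞ (f i)) (hv : ∀ k, Summable (v k))
    (h'f : ∀ (k : ℕ) (i : α) (x : E), ‖x‖ ≤ R → ‖iteratedFDeriv ℝ k (f i) x‖ ≤ v k i) :
    ContDiffAt ℝ ∞ (fun x => ∑' i, f i x) 0 :=
  (contDiffAt_tsum_and_iteratedFDeriv_eq hR hf hv h'f).1

/-- **Term-by-term iterated derivatives at `0`** from summable derivative bounds on a ball
(localized `iteratedFDeriv_tsum`). [folklore] -/
theorem iteratedFDeriv_tsum_apply_zero_of_norm_iteratedFDeriv_le {α : Type*} {f : α → E → F}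
    {v : ℕ → α → ℝ} {R : ℝ} (hR : 0 < R) (hf : ∀ i, ContDiff ℝ ∞ (f i)) (hv : ∀ k, Summable (v k))
    (h'f : ∀ (k : ℕ) (i : α) (x : E), ‖x‖ ≤ R → ‖iteratedFDeriv ℝ k (f i) x‖ ≤ v k i) (k : ℕ) :
    iteratedFDeriv ℝ k (fun x => ∑' i, f i x) 0 = ∑' i, iteratedFDeriv ℝ k (f i) 0 :=
  (contDiffAt_tsum_and_iteratedFDeriv_eq hR hf hv h'f).2 k

/-- **The bound on the derivatives of the series at `0`**: under the same hypotheses,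
`‖iteratedFDeriv ℝ k (∑' i, f i ·) 0‖ ≤ ∑_i v k i`. [folklore] -/
theorem norm_iteratedFDeriv_tsum_apply_zero_le {α : Type*} {f : α → E → F} {v : ℕ → α → ℝ}
    {R : ℝ} (hR : 0 < R) (hf : ∀ i, ContDiff ℝ ∞ (f i)) (hv : ∀ k, Summable (v k))
    (h'f : ∀ (k : ℕ) (i : α) (x : E), ‖x‖ ≤ R → ‖iteratedFDeriv ℝ k (f i) x‖ ≤ v k i) (k : ℕ) :
    ‖iteratedFDeriv ℝ k (fun x => ∑' i, f i x) 0‖ ≤ ∑' i, v k i := by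
  rw [iteratedFDeriv_tsum_apply_zero_of_norm_iteratedFDeriv_le hR hf hv h'f k]
  have hb : ∀ i, ‖iteratedFDeriv ℝ k (f i) 0‖ ≤ v k i := fun i =>
    h'f k i 0 (by rw [norm_zero]; exact hR.le)
  exact tsum_of_norm_bounded (hv k).hasSum hb

end Literature.Analysis.Calculus
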